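import Mathlib
import HarnessLib
import Summits.CriticalPhenomena.CardyFormulaZ2.Theorems.CardyMagicRigidityMagicFormulaTPowerSumMoments
import Summits.CriticalPhenomena.CardyFormulaZ2.Theorems.CardyMagicRigidityMagicFormulaTExistsLimitCoupling
import Literature.MathematicalPhysics.QuantumFieldTheory.ContinuumLimitsTrivialityAssemblyProofs

/-!
# Existence of `lim_δ E_{1/2}[A₁²]` modulo CN + SW — part 1a/3: band moments of the small-loop phase sum
(crux `MagicFormulaT`, line `Sketch` v10, sub-goal `el_existsLimitA1sq_of_facts`)

Crux `Summit.CriticalPhenomena.CardyFormulaZ2.Theses.CardyMagicRigidity.MagicFormulaT`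
(stmt-CriticalPhenomena-4836), line `Sketch`, skeleton v10, wave 5, registered sub-goal
`el_existsLimitA1sq_of_facts`: modulo Camia–Newman and Smirnov–Werner the limit of `E_{1/2}[A₁²]`,
`A₁ = Σ_u θ_u` (`θ_u = u.nestingPhase f`, loops of `siteLoopConfig δ ω` under `triSitePercolation half`),
exists as `δ → 0⁺`.  This file carries the lattice UV input of the Cauchy argument (registered helper
`ela1_bandMoments`); part 1b (`…ExistsLimitA1sqUV.lean`, `ela1_uv`) turns it into the UV step for `E[A₁²]`.

Notation.  `X_t = Σ_{u ∈ bigLoops t} θ_u` (big-loop phase sum), `Θ_t = Σ_{diam u < t} θ_u` (band sum), so that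
pathwise `A₁ = Θ_t + X_t` (`ela1_finsum_split`).

* §1 elementary inequalities: `x² ≤ eˣ + e⁻ˣ − 2`, the power mean `(m⁻¹Σ a_j)⁴ ≤ m⁻¹ Σ a_j⁴` (twice
  `el_sq_avg_le`), and a few algebraic identities used with opaque atoms (`x⁴ ≤ 24(eˣ + e⁻ˣ)` is the tree's
  `QuantumFieldTheory.pow_four_le_exp_add_exp_neg`).
* §2 pathwise: the split `A₁ = Θ_t + X_t` (finite supports on the lattice, `uva_finite_support_nestingPhase`) and,
  for `t ≤ 1`, `Θ_t` is the inner statistic over `B(0, |R|+2)` of the band-restricted phase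
  (`sw_meets_of_nestingPhase_ne_zero`, `sw_range_subset_ball`).
* §3 band moments, uniformly in `0 < δ ≤ t ≤ 1`: `E e^{±Θ_t} ≤ exp(K₀ (πC)² (|R|+2)³ t)` (`stub_bandExpMoment` on
  `tEns` with `|θ_u| ≤ πC diam²`, `uva_band_dom_sq`, and the EXACT centring `E Θ_t = 0`, `stub_bandCentring`),
  hence (`ela1_bandMoments`, registered) `E Θ_t² ≤ 2(exp(K₀(πC)²(|R|+2)³ t) − 1) → 0` (`t → 0`) and
  `E Θ_t⁴ ≤ 48 exp(K₀(πC)²(|R|+2)³ t)` (`x² ≤ eˣ + e⁻ˣ − 2`, `x⁴ ≤ 24(eˣ + e⁻ˣ)`).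
* §4 measurability of `X_t` and of the threshold averages `m⁻¹Σ_j X_{η_j}` (`FirstMoment.measurable_finsum_loops_sep`).

No definition, no cited fact; tree material only (helper prefix `ela1_`).
-/

noncomputable section

namespace Summit.CriticalPhenomena.CardyFormulaZ2.Cruxes.MagicFormulaT.LineSketch

open MeasureTheory Filter Set Metric
open scoped Real Topology BigOperators ENNReal
open Literature.Probability.RandomPlanarGeometry Literature.Probability.Percolation
  Literature.Probability.LatticeModels
open Summit.CriticalPhenomena.CardyFormulaZ2.Cruxes.NestingRigidity.RingCloudTomography
open Summit.CriticalPhenomena.CardyFormulaZ2.Cruxes.NestingRigidity.PositiveConeWeightDoubling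

/-! ## §1 Elementary inequalities -/

/-- `x² ≤ eˣ + e⁻ˣ − 2` (the first two terms of the cosh series). -/
theorem ela1_sq_le_exp_add (x : ℝ) : x ^ 2 ≤ Real.exp x + Real.exp (-x) - 2 := by
  have h := sum_le_hasSum (Finset.range 2)
    (fun n _ ↦ div_nonneg (by rw [pow_mul]; positivity) (Nat.cast_nonneg _)) (Real.hasSum_cosh x)
  rw [Real.cosh_eq] at h
  simp only [Finset.sum_range_succ, Finset.sum_range_zero, Nat.factorial, mul_zero, pow_zero,
    Nat.cast_one, div_one, mul_one, zero_add] at h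
  norm_num [Nat.factorial] at h
  linarith

/-- Power mean of order four: `(m⁻¹ Σ a_j)⁴ ≤ m⁻¹ Σ a_j⁴` (Jensen `el_sq_avg_le` applied twice). -/
theorem ela1_pow_four_avg_le {m : ℕ} (a : ℕ → ℝ) :
    ((∑ j ∈ Finset.range m, a j) / m) ^ 4 ≤ (∑ j ∈ Finset.range m, a j ^ 4) / m := by
  have h1 := el_sq_avg_le (m := m) a
  have h2 := el_sq_avg_le (m := m) (fun j ↦ a j ^ 2)
  calc ((∑ j ∈ Finset.range m, a j) / m) ^ 4 = (((∑ j ∈ Finset.range m, a j) / m) ^ 2) ^ 2 := by ring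
    _ ≤ ((∑ j ∈ Finset.range m, a j ^ 2) / m) ^ 2 := pow_le_pow_left₀ (sq_nonneg _) h1 2
    _ ≤ (∑ j ∈ Finset.range m, (a j ^ 2) ^ 2) / m := h2
    _ = (∑ j ∈ Finset.range m, a j ^ 4) / m := by
        congr 1
        exact Finset.sum_congr rfl fun j _ ↦ by ring

/-- `(2x − y)² ≤ 8x² + 2y²`. -/
theorem ela1_sq_two_mul_sub_le (x y : ℝ) : (2 * x - y) ^ 2 ≤ 8 * x ^ 2 + 2 * y ^ 2 := by
  nlinarith [sq_nonneg (2 * x + y)]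

/-- `|x² − (x − t)²| = |t| |2x − t| ≤ (s/2) t² + (2x − t)²/(2s)` (`uva_abs_mul_le`). -/
theorem ela1_abs_sq_sub_sq_le {s : ℝ} (hs : 0 < s) (x t : ℝ) :
    |x ^ 2 - (x - t) ^ 2| ≤ s / 2 * t ^ 2 + 1 / (2 * s) * (2 * x - t) ^ 2 := by
  rw [show x ^ 2 - (x - t) ^ 2 = t * (2 * x - t) by ring, abs_mul]
  exact uva_abs_mul_le _ _ hs

/-- Averages: if `x = b_j + a_j` for all `j < m` (`m > 0`) then `m⁻¹Σ a_j = x − m⁻¹Σ b_j`. -/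
theorem ela1_avg_eq_sub {m : ℕ} (hm : (0 : ℝ) < m) {a b : ℕ → ℝ} {x : ℝ}
    (h : ∀ j ∈ Finset.range m, x = b j + a j) :
    (∑ j ∈ Finset.range m, a j) / (m : ℝ) = x - (∑ j ∈ Finset.range m, b j) / (m : ℝ) := by
  have h1 : ∑ j ∈ Finset.range m, a j = ∑ j ∈ Finset.range m, (x - b j) :=
    Finset.sum_congr rfl fun j hj ↦ by rw [h j hj]; ring
  rw [h1, Finset.sum_sub_distrib, Finset.sum_const, Finset.card_range, nsmul_eq_mul]
  field_simp

/-- The average of a constant. -/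
theorem ela1_avg_const {m : ℕ} (hm : (0 : ℝ) < m) (x : ℝ) : (∑ _j ∈ Finset.range m, x) / (m : ℝ) = x := by
  rw [Finset.sum_const, Finset.card_range, nsmul_eq_mul]
  field_simp

/-! ## §2 Pathwise: the split `A₁ = Θ_t + X_t` and the band sum as an inner statistic -/

section Pathwise

variable {f : ℂ → ℝ} {R C : ℝ}

/-- **Pathwise split at a threshold**: on the lattice (mesh `δ > 0`) the phase sum over all loops is the band
sum (`diam < t`) plus the big-loop sum (`diam ≥ t`) — both honest finite sums, the phase being supported on the
finitely many loops meeting `B̄(0, R)` (`uva_finite_support_nestingPhase`). -/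
theorem ela1_finsum_split (hR : ∀ z, R < ‖z‖ → f z = 0) (h0 : ∫ z, f z = 0) {δ : ℝ} (hδ : 0 < δ)
    (ω : SiteConfig (Site 2)) (t : ℝ) :
    ∑ᶠ u ∈ (siteLoopConfig δ ω).loops, u.nestingPhase f =
      (∑ᶠ u ∈ {u ∈ (siteLoopConfig δ ω).loops | diam u.range < t}, u.nestingPhase f) +
        ∑ᶠ u ∈ (siteLoopConfig δ ω).bigLoops t, u.nestingPhase f := by
  have hunion : (siteLoopConfig δ ω).loops =
      {u ∈ (siteLoopConfig δ ω).loops | diam u.range < t} ∪ (siteLoopConfig δ ω).bigLoops t := by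
    ext u
    simp only [mem_setOf_eq, mem_union, LoopConfig.mem_bigLoops_iff]
    constructor
    · intro hu
      rcases lt_or_ge (diam u.range) t with h | h
      · exact Or.inl ⟨hu, h⟩
      · exact Or.inr ⟨hu, h⟩
    · rintro (⟨hu, -⟩ | ⟨hu, -⟩) <;> exact hu
  have hdisj : Disjoint {u ∈ (siteLoopConfig δ ω).loops | diam u.range < t}
      ((siteLoopConfig δ ω).bigLoops t) := by
    rw [Set.disjoint_left]
    rintro u ⟨-, h⟩ ⟨-, h'⟩
    exact absurd h (not_lt.2 h')
  conv_lhs => rw [hunion]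
  exact finsum_mem_union' hdisj (uva_finite_support_nestingPhase tEns tEns_mem hδ hR h0 ω _)
    (uva_finite_support_nestingPhase tEns tEns_mem hδ hR h0 ω fun u ↦ t ≤ diam u.range)

/-- **The band sum is an inner statistic** (`t ≤ 1`): `Σ_{diam u < t} θ_u` equals the sum over the loops inside
`B(0, |R| + 2)` of the band-restricted phase `[0 ≤ diam u < t] θ_u` (a loop with `θ_u ≠ 0` meets `B̄(0, R)`,
`sw_meets_of_nestingPhase_ne_zero`, and then lies in the ball, `sw_range_subset_ball`). -/
theorem ela1_band_eq_inner (hR : ∀ z, R < ‖z‖ → f z = 0) (h0 : ∫ z, f z = 0) {t : ℝ} (ht1 : t ≤ 1)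
    (L : Set (UnbasedLoop ℂ)) :
    ∑ᶠ u ∈ {u ∈ L | diam u.range < t}, u.nestingPhase f =
      ∑ᶠ u ∈ {u ∈ L | u.range ⊆ ball (0 : ℂ) (|R| + 2)},
        (if 0 ≤ diam u.range ∧ diam u.range < t then u.nestingPhase f else 0) := by
  have h1 : ∑ᶠ u ∈ {u ∈ L | diam u.range < t}, u.nestingPhase f =
      ∑ᶠ u ∈ {u ∈ L | diam u.range < t},
        (if 0 ≤ diam u.range ∧ diam u.range < t then u.nestingPhase f else 0) :=
    finsum_mem_congr rfl fun u hu ↦ (if_pos ⟨diam_nonneg, hu.2⟩).symm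
  rw [h1]
  refine finsum_mem_inter_support_eq' _ _ _ fun u hu ↦ ?_
  obtain ⟨hband, hθ⟩ := ite_ne_right_iff.1 (Function.mem_support.1 hu)
  simp only [mem_setOf_eq]
  exact ⟨fun h ↦ ⟨h.1, sw_range_subset_ball ht1 u hband.2 (sw_meets_of_nestingPhase_ne_zero hR h0 hθ)⟩,
    fun h ↦ ⟨h.1, hband.2⟩⟩

end Pathwise

/-! ## §3 Band exponential moments and band moments, uniformly in `0 < δ ≤ t ≤ 1` -/

section Band

variable {f : ℂ → ℝ} {R C : ℝ}

/-- **Band exponential moments**: there is `K₀ > 0` with `E e^{aΘ_t} ≤ exp(K₀ a² (πC)² (|R|+2)³ t)` for all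
`0 < δ ≤ t ≤ 1`, `|a| ≤ 1` (`stub_bandExpMoment` on `tEns` for the band-restricted phase over `B(0, |R|+2)`,
`|θ_u| ≤ πC diam²`, together with the exact centring `E Θ_t = 0`, `stub_bandCentring`). -/
theorem ela1_band_expMoment (hf : Measurable f) (hC : ∀ z, |f z| ≤ C) (hR : ∀ z, R < ‖z‖ → f z = 0)
    (h0 : ∫ z, f z = 0) : ∃ K₀ : ℝ, 0 < K₀ ∧ ∀ (δ t a : ℝ), 0 < δ → δ ≤ t → t ≤ 1 → |a| ≤ 1 →
    Integrable (fun ω ↦ Real.exp (a * ∑ᶠ u ∈ {u ∈ (siteLoopConfig δ ω).loops | diam u.range < t},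
      u.nestingPhase f)) (triSitePercolation half) ∧
    ∫ ω, Real.exp (a * ∑ᶠ u ∈ {u ∈ (siteLoopConfig δ ω).loops | diam u.range < t},
      u.nestingPhase f) ∂(triSitePercolation half) ≤
      Real.exp (K₀ * a ^ 2 * (π * C) ^ 2 * (|R| + 2) ^ 3 * t) := by
  have hC0 : 0 ≤ C := nonneg_of_abs_le hC
  set κ₁ : ℝ := π * C with hκ₁def
  have hκ₁0 : 0 ≤ κ₁ := by positivity
  obtain ⟨K₀, hK₀, hS1⟩ := stub_bandExpMoment tEns tEns_mem (κ₁ * (|R| + 2) ^ 2)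
  refine ⟨K₀, hK₀, fun δ t a hδ hδt ht1 ha ↦ ?_⟩
  have htρ : t ≤ |R| + 2 := by linarith [abs_nonneg R]
  set D : Set ℂ := ball (0 : ℂ) (|R| + 2) with hDdef
  set gs : UnbasedLoop ℂ → ℝ := fun u ↦
    if 0 ≤ diam u.range ∧ diam u.range < t then u.nestingPhase f else 0 with hgsdef
  have hdom : ∀ u : UnbasedLoop ℂ, u.range ⊆ D → |gs u| ≤ κ₁ * diam u.range ^ 2 :=
    fun u _ ↦ uva_band_dom_sq hC hR 0 t u
  have hvan : ∀ u : UnbasedLoop ℂ, u.range ⊆ D → t ≤ diam u.range → gs u = 0 :=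
    fun u _ hbu ↦ uva_band_vanish hbu _
  have horder : |a| * κ₁ * (|R| + 2) ^ 2 ≤ κ₁ * (|R| + 2) ^ 2 := by
    have : 0 ≤ κ₁ * (|R| + 2) ^ 2 := by positivity
    nlinarith
  -- the inner statistic is the band sum, pathwise
  have heq : ∀ ω : tEns.Ω, (∑ᶠ u ∈ {u ∈ (tEns.X δ ω).loops | u.range ⊆ D}, gs u) =
      ∑ᶠ u ∈ {u ∈ (tEns.X δ ω).loops | diam u.range < t}, u.nestingPhase f :=
    fun ω ↦ (ela1_band_eq_inner hR h0 ht1 _).symm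
  -- exact centring
  have hcs : ∫ ω', (∑ᶠ u ∈ {u ∈ (tEns.X δ ω').loops | u.range ⊆ D}, gs u) ∂tEns.P = 0 :=
    (integral_congr_ae (Eventually.of_forall heq)).trans
      (stub_bandCentring tEns tEns_mem f R C δ t hf hC hR h0 hδ)
  have hS := hS1 0 (|R| + 2) κ₁ a δ t D gs hδ hδt htρ hκ₁0 subset_rfl hdom hvan horder
  simp only [hcs, sub_zero] at hS
  simp_rw [heq] at hS
  exact ⟨hS.1, hS.2⟩

/-- **Registered helper `ela1_bandMoments` (sub-goal of `el_existsLimitA1sq_of_facts`, line `Sketch` v10):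
band moments of the small-loop phase sum, uniformly in the mesh.**  For an admissible density there is `K₀ > 0`
with, for all `0 < δ ≤ t ≤ 1` and `c_t = K₀ (πC)² (|R|+2)³ t`: `Θ_t²`, `Θ_t⁴` are integrable,
`E Θ_t² ≤ 2(e^{c_t} − 1)` and `E Θ_t⁴ ≤ 48 e^{c_t}`, `Θ_t = Σ_{diam u < t} θ_u` (`ela1_band_expMoment` at
`a = ±1`). -/
theorem ela1_bandMoments : ∀ (f : ℂ → ℝ) (R C : ℝ), Measurable f → (∀ z, |f z| ≤ C) →
    (∀ z, R < ‖z‖ → f z = 0) → ∫ z, f z = 0 → ∃ K₀ : ℝ, 0 < K₀ ∧ ∀ (δ t : ℝ), 0 < δ → δ ≤ t → t ≤ 1 →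
    Integrable (fun ω ↦ (∑ᶠ u ∈ {u ∈ (siteLoopConfig δ ω).loops | Metric.diam u.range < t},
      u.nestingPhase f) ^ 2) (triSitePercolation half) ∧
    ∫ ω, (∑ᶠ u ∈ {u ∈ (siteLoopConfig δ ω).loops | Metric.diam u.range < t}, u.nestingPhase f) ^ 2
      ∂(triSitePercolation half) ≤ 2 * (Real.exp (K₀ * (π * C) ^ 2 * (|R| + 2) ^ 3 * t) - 1) ∧
    Integrable (fun ω ↦ (∑ᶠ u ∈ {u ∈ (siteLoopConfig δ ω).loops | Metric.diam u.range < t},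
      u.nestingPhase f) ^ 4) (triSitePercolation half) ∧
    ∫ ω, (∑ᶠ u ∈ {u ∈ (siteLoopConfig δ ω).loops | Metric.diam u.range < t}, u.nestingPhase f) ^ 4
      ∂(triSitePercolation half) ≤ 48 * Real.exp (K₀ * (π * C) ^ 2 * (|R| + 2) ^ 3 * t) := by
  intro f R C hf hC hR h0
  obtain ⟨K₀, hK₀, h⟩ := ela1_band_expMoment hf hC hR h0
  refine ⟨K₀, hK₀, fun δ t hδ hδt ht1 ↦ ?_⟩
  set P : Measure (SiteConfig (Site 2)) := triSitePercolation half with hPdef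
  set Θ : SiteConfig (Site 2) → ℝ := fun ω ↦
    ∑ᶠ u ∈ {u ∈ (siteLoopConfig δ ω).loops | diam u.range < t}, u.nestingPhase f with hΘdef
  set c : ℝ := K₀ * (π * C) ^ 2 * (|R| + 2) ^ 3 * t with hcdef
  obtain ⟨hIp, hEp⟩ := h δ t 1 hδ hδt ht1 (by norm_num)
  obtain ⟨hIm, hEm⟩ := h δ t (-1) hδ hδt ht1 (by norm_num)
  simp only [one_mul, one_pow, mul_one] at hIp hEp
  simp only [neg_one_mul, neg_one_sq, mul_one] at hIm hEm
  have hIp' : Integrable (fun ω ↦ Real.exp (Θ ω)) P := hIp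
  have hIm' : Integrable (fun ω ↦ Real.exp (-Θ ω)) P := hIm
  have hEp' : ∫ ω, Real.exp (Θ ω) ∂P ≤ Real.exp c := hEp
  have hEm' : ∫ ω, Real.exp (-Θ ω) ∂P ≤ Real.exp c := hEm
  have hmeas : Measurable Θ :=
    FirstMoment.measurable_finsum_loops_sep tEns tEns_mem δ (fun u ↦ diam u.range < t)
      (fun u ↦ u.nestingPhase f)
  have hIsum : Integrable (fun ω ↦ Real.exp (Θ ω) + Real.exp (-Θ ω)) P := hIp'.add hIm'
  -- second moment
  have hI2 : Integrable (fun ω ↦ Θ ω ^ 2) P :=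
    (hIsum.sub (integrable_const 2)).mono' (hmeas.pow_const 2).aestronglyMeasurable
      (Eventually.of_forall fun ω ↦ by
        rw [Real.norm_eq_abs, abs_of_nonneg (sq_nonneg _)]
        exact ela1_sq_le_exp_add _)
  have hE2 : ∫ ω, Θ ω ^ 2 ∂P ≤ 2 * (Real.exp c - 1) := by
    calc ∫ ω, Θ ω ^ 2 ∂P ≤ ∫ ω, (Real.exp (Θ ω) + Real.exp (-Θ ω) - 2) ∂P :=
          integral_mono hI2 (hIsum.sub (integrable_const 2)) fun ω ↦ ela1_sq_le_exp_add _
      _ = ∫ ω, Real.exp (Θ ω) ∂P + ∫ ω, Real.exp (-Θ ω) ∂P - 2 := by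
          rw [integral_sub hIsum (integrable_const 2), integral_add hIp' hIm', integral_const, smul_eq_mul,
            probReal_univ, one_mul]
      _ ≤ Real.exp c + Real.exp c - 2 := by gcongr
      _ = 2 * (Real.exp c - 1) := by ring
  -- fourth moment
  have hI4 : Integrable (fun ω ↦ Θ ω ^ 4) P :=
    (hIsum.const_mul 24).mono' (hmeas.pow_const 4).aestronglyMeasurable
      (Eventually.of_forall fun ω ↦ by
        rw [Real.norm_eq_abs, abs_of_nonneg (by positivity)]
        exact Literature.MathematicalPhysics.QuantumFieldTheory.pow_four_le_exp_add_exp_neg _)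
  have hE4 : ∫ ω, Θ ω ^ 4 ∂P ≤ 48 * Real.exp c := by
    calc ∫ ω, Θ ω ^ 4 ∂P ≤ ∫ ω, 24 * (Real.exp (Θ ω) + Real.exp (-Θ ω)) ∂P :=
          integral_mono hI4 (hIsum.const_mul 24) fun ω ↦
            Literature.MathematicalPhysics.QuantumFieldTheory.pow_four_le_exp_add_exp_neg _
      _ = 24 * (∫ ω, Real.exp (Θ ω) ∂P + ∫ ω, Real.exp (-Θ ω) ∂P) := by
          rw [integral_const_mul, integral_add hIp' hIm']
      _ ≤ 24 * (Real.exp c + Real.exp c) := by gcongr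
      _ = 48 * Real.exp c := by ring
  exact ⟨hI2, hE2, hI4, hE4⟩

end Band

/-! ## §4 Measurability of the big-loop sums and of their threshold averages -/

/-- The big-loop phase sum `X_t` is measurable on the lattice (`FirstMoment.measurable_finsum_loops_sep`). -/
theorem ela1_measurable_bigSum (f : ℂ → ℝ) (δ t : ℝ) :
    Measurable fun ω ↦ ∑ᶠ u ∈ (siteLoopConfig δ ω).bigLoops t, u.nestingPhase f :=
  FirstMoment.measurable_finsum_loops_sep tEns tEns_mem δ (fun u ↦ t ≤ diam u.range)
    (fun u ↦ u.nestingPhase f)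

/-- The threshold average `X̄ = m⁻¹ Σ_{j<m} X_{η_j}` is measurable on the lattice. -/
theorem ela1_measurable_avg (f : ℂ → ℝ) (δ η : ℝ) (m : ℕ) :
    Measurable fun ω ↦ (∑ j ∈ Finset.range m, ∑ᶠ u ∈ (siteLoopConfig δ ω).bigLoops
      (η / 2 + ((j : ℝ) + 1) * η / (2 * m)), u.nestingPhase f) / m :=
  (Finset.measurable_sum _ fun _ _ ↦ ela1_measurable_bigSum f δ _).div_const _

end Summit.CriticalPhenomena.CardyFormulaZ2.Cruxes.MagicFormulaT.LineSketch

end
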